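/-
Copyright: the b2b-balaban cell (near-miss cell 7), T⁴-continuum fan-out, lineage t4-ne7b-p1 (node U5c COUNT member).
Released under the licence of the surrounding project.
-/
import Summits.QuantumFields.BalabanUV.T4Continuum.Support.CrowdingBudget
import Summits.QuantumFields.BalabanUV.T4Continuum.Support.CrowdingRoots
import Summits.QuantumFields.BalabanUV.T4Continuum.Support.CrowdingAnalysis

/-!
# Crowding (crowding theorem, part 3): the genealogy-level gluing

Summits-side support leaf of the T⁴-continuum cell (rung (B)+1 on a FINITE torus only; NOT infinite volume, NOT the
mass gap, NOT the Clay statement; NOT a proof of the spine estimate NE7b).  Lineage `t4-ne7b-p1`, node U5c, wall (GM)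
of the cell's gap census, located item G-ne7bp1g18-2 part (II): who pays the merger crowding `∏_Z q_Z^d` when the ZONE
form of the placement assembly (one term per merger) replaces the pair sum.  [folklore] finite combinatorics ∕ real
analysis over the cell's OWN carrier (`T4PersistenceDictionary.Gen PEv`, `PEv = (step, kind, fat)`); nothing is quoted
from print; nothing printed is asserted; no `[cite:]` tag.

THE CROWDING THEOREM (`crowding`).  For a well-formed genealogy `G : Gen PEv` with consistent step data
(`StepsOK PEv.step G`), ordered mergers (`Ordered PEv.step G`) and births of kind `0`, for every zone exponent `p ≥ 0`,
contraction ratio `σ ∈ (0,1)` and rates `ε, θ > 0`: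

  `Σ_{e ∈ merges G} p · log Q(cnt G, σ, step e)
      ≤ θ · Σ_{b ∈ births G} (d′_b + 1) + ε · partnerAges PEv.step G
          + crowdA p σ (min(ε, θ∕2)∕16) · #(births G ∪ merges G)`,

where `cnt G t` is the number of formation events (births and mergers) of `G` at step `t` and
`Q n σ t = Σ_{s ≤ t} n_s σ^{2(t−s)}` is the discounted crowding of part 2 (`CrowdingAnalysis`).  In words: the total
zone-crowding cost of all mergers is paid by a `θ`-sliver of the quadratic birth credit (routed as in parts 3∕3b,
`lowerA`), an `ε`-sliver of the placement rate (`Λ′ ↦ Λ′e^{ε}`), and a per-event constant (into the menu).  Product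
form: `prod_rpow_Q_le`.

PROOF (all pieces exist in parts 1, 1b, 2).  (i) regroup the cost by steps: at step `t` the `m_t` mergers each cost
`p·log Q(t)`, and `m_t ≤ n_t = cnt G t` (with `log Q(t) ≥ 0` as soon as `n_t ≥ 1`, `self_le_Q`); (ii) `cost_le` of
part 2 at `η = min(ε, θ∕2)∕16`: `Σ_t p n_t log Q(t) ≤ 2η Σ_t n_t√n_t + crowdA·Σ_t n_t`; (iii) per step
`n_t√n_t ≤ 8·(β_t√β_t + m_t√m_t)∕(2√2)` (`n_t ≤ β_t + m_t ≤ 2·max`, `x ↦ x√x` monotone), the births part is paid by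
`card_mul_sqrt_le_sum_fat_birthsAt` (distinct classes at one step, rate `θ∕2`), the mergers part by `youngerRoot_budget`
with the matching `youngerRoot G` of part 1b (injective into the births, `step ≤ t + 1`), whose ages sum to
`partnerAges` (`sum_age_youngerRoot`) and whose classes are dominated by `(θ∕2)·Σ_births (d′+1)` (injectivity);
(iv) `Σ_t n_t = #(births ∪ merges)`.

LOCATED, NOT DONE HERE.  The abstract ZONE SKELETON (contraction law of extents, zone-touch count, `q_Z ≤ Q(cnt G)` from
the chronology of sub-events) and the re-typed chain binder `hlabZ` are part 4; the identification (ID) of the carrier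
with Bałaban's large-field histories (gap G-ne7bp1g9-1) and the per-record price (E2)∕(R1) (G-ne7bp1-1) remain NOT
PRINTED.  NE7b discharge: no date.

HONEST DEPENDENCY (cell): continuum YM on T⁴ ⇐ BetaPertH ∧ nine spine estimates (0/9 proved); BetaPertH ⇐ (D1) ∧ (D4)
∧ CAP+tail.  This file changes none of it.
-/

namespace Summit.QuantumFields.BalabanUV.T4Continuum.Crowding

open Finset
open Literature.MathematicalPhysics.QuantumFieldTheory.Balaban1983to89
open T4PersistenceDictionary T4PartnerMultiplicity
open Summit.QuantumFields.BalabanUV.T4Continuum.PlacementSkeleton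
open Summit.QuantumFields.BalabanUV.T4Continuum.PlacementBatch

noncomputable section

/-! ## §1 Formation events and per-step counts -/

/-- The FORMATION EVENTS of a genealogy over the dictionary's alphabet: its births and its mergers (renewals do not
move zones). [folklore] -/
def bm (G : Gen PEv) : Finset PEv := births G ∪ merges G

/-- The number of formation events of `G` at step `t` (`n_t`). [folklore] -/
def cnt (G : Gen PEv) (t : ℕ) : ℕ := ((bm G).filter fun e => e.step = t).card

/-- The mergers of `G` at step `t` (`m_t` of them). [folklore] -/
def mergesAt (G : Gen PEv) (t : ℕ) : Finset PEv := (merges G).filter fun e => e.step = t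

/-- The HORIZON of `G`: the latest step of a formation event. [folklore] -/
def horizon (G : Gen PEv) : ℕ := (bm G).sup PEv.step

/-- every formation event happens by the horizon [folklore] -/
theorem step_le_horizon {G : Gen PEv} {e : PEv} (he : e ∈ bm G) : e.step ≤ horizon G :=
  le_sup (f := PEv.step) he

/-- the step of a formation event lies in `range (horizon + 1)` [folklore] -/
theorem step_mem_range {G : Gen PEv} {e : PEv} (he : e ∈ bm G) : e.step ∈ range (horizon G + 1) :=
  mem_range.2 (Nat.lt_succ_of_le (step_le_horizon he))

/-- With births of kind `0`, the births at step `t` are the births filtered by step alone. [folklore] -/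
theorem birthsAt_eq_filter {E : Finset PEv} (hk : ∀ e ∈ E, e.kind = 0) (t : ℕ) :
    birthsAt E t = E.filter fun e => e.step = t :=
  filter_congr fun e he => by simp [hk e he]

/-- `n_t ≤ β_t + m_t` [folklore] -/
theorem cnt_le {G : Gen PEv} (hk : ∀ b ∈ births G, b.kind = 0) (t : ℕ) :
    cnt G t ≤ (birthsAt (births G) t).card + (mergesAt G t).card := by
  rw [cnt, bm, filter_union, birthsAt_eq_filter hk, mergesAt]
  exact card_union_le _ _

/-- `m_t ≤ n_t` [folklore] -/
theorem card_mergesAt_le_cnt (G : Gen PEv) (t : ℕ) : (mergesAt G t).card ≤ cnt G t :=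
  card_le_card (filter_subset_filter _ subset_union_right)

/-- a merger is counted at its own step: `1 ≤ n_{step e}` [folklore] -/
theorem one_le_cnt_of_mem {G : Gen PEv} {e : PEv} (he : e ∈ merges G) : 1 ≤ cnt G e.step :=
  card_pos.2 ⟨e, mem_filter.2 ⟨mem_union_right _ he, rfl⟩⟩

/-- hence `1 ≤ Q(n, σ, step e)` at every merger [folklore] -/
theorem one_le_Q_of_mem {G : Gen PEv} {σ : ℝ} (hσ : 0 ≤ σ) {e : PEv} (he : e ∈ merges G) :
    1 ≤ Q (cnt G) σ e.step :=
  le_trans (by exact_mod_cast one_le_cnt_of_mem he) (self_le_Q (cnt G) hσ e.step)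

/-! ## §2 The elementary convexity step -/

/-- `8·(x∕(2√2)) = 2√2·x` [folklore] -/
theorem eight_mul_div (x : ℝ) : 8 * (x / (2 * Real.sqrt 2)) = 2 * Real.sqrt 2 * x := by
  have h2 : Real.sqrt 2 * Real.sqrt 2 = 2 := Real.mul_self_sqrt (by norm_num)
  have hc : (2 * Real.sqrt 2 : ℝ) ≠ 0 := by positivity
  have h8 : (8 : ℝ) = 2 * Real.sqrt 2 * (2 * Real.sqrt 2) := by
    calc (8 : ℝ) = 4 * (Real.sqrt 2 * Real.sqrt 2) := by rw [h2]; norm_num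
      _ = 2 * Real.sqrt 2 * (2 * Real.sqrt 2) := by ring
  calc 8 * (x / (2 * Real.sqrt 2)) = (2 * Real.sqrt 2 * x) * (2 * Real.sqrt 2) / (2 * Real.sqrt 2) := by
        rw [h8]; ring
    _ = 2 * Real.sqrt 2 * x := mul_div_cancel_right₀ _ hc

/-- If `n ≤ a + b` then `n√n ≤ 8·(a√a∕(2√2) + b√b∕(2√2))` (naturals; via `n ≤ 2·max`). [folklore] -/
theorem mul_sqrt_le_of_le_add {n a b : ℕ} (h : n ≤ a + b) :
    (n : ℝ) * Real.sqrt n ≤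
      8 * ((a : ℝ) * Real.sqrt a / (2 * Real.sqrt 2) + (b : ℝ) * Real.sqrt b / (2 * Real.sqrt 2)) := by
  rw [mul_add, eight_mul_div, eight_mul_div]
  wlog hab : b ≤ a generalizing a b
  · have h' := this (a := b) (b := a) (by omega) (le_of_not_ge hab)
    linarith
  have hn : (n : ℝ) ≤ 2 * a := by exact_mod_cast (h.trans (by omega))
  have h1 : (n : ℝ) * Real.sqrt n ≤ (2 * a : ℝ) * Real.sqrt (2 * a) :=
    mul_le_mul hn (Real.sqrt_le_sqrt hn) (Real.sqrt_nonneg _) (by positivity)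
  have h2 : Real.sqrt (2 * (a : ℝ)) = Real.sqrt 2 * Real.sqrt a := Real.sqrt_mul (by norm_num) _
  rw [h2] at h1
  have hb : 0 ≤ (b : ℝ) * Real.sqrt b := by positivity
  have hs : 0 ≤ Real.sqrt 2 := Real.sqrt_nonneg 2
  nlinarith

/-! ## §3 The budget side, summed over steps -/

variable (W : PEv → ℕ)

/-- **BIRTHS.**  `Σ_{t ≤ T} β_t√β_t∕(2√2) ≤ Σ_{b ∈ births G} (d′_b + 1)` once all births have step `≤ T`. [folklore] -/
theorem births_budget {G : Gen PEv} (hk : ∀ b ∈ births G, b.kind = 0) {T : ℕ}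
    (hT : ∀ b ∈ births G, b.step ∈ range (T + 1)) :
    ∑ t ∈ range (T + 1), ((birthsAt (births G) t).card : ℝ) * Real.sqrt (birthsAt (births G) t).card /
        (2 * Real.sqrt 2) ≤ ∑ b ∈ births G, ((b.fat : ℝ) + 1) :=
  calc ∑ t ∈ range (T + 1), ((birthsAt (births G) t).card : ℝ) * Real.sqrt (birthsAt (births G) t).card /
        (2 * Real.sqrt 2) ≤ ∑ t ∈ range (T + 1), ∑ e ∈ birthsAt (births G) t, ((e.fat : ℝ) + 1) :=
        sum_le_sum fun t _ => card_mul_sqrt_le_sum_fat_birthsAt (births G) t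
    _ = ∑ t ∈ range (T + 1), ∑ e ∈ (births G).filter (fun e => e.step = t), ((e.fat : ℝ) + 1) :=
        sum_congr rfl fun t _ => by rw [birthsAt_eq_filter hk]
    _ = ∑ b ∈ births G, ((b.fat : ℝ) + 1) := sum_fiberwise_of_maps_to hT _

/-- **MERGERS.**  `Σ_{t ≤ T} min(ε,θ∕2)·m_t√m_t∕(2√2) ≤ (θ∕2)·Σ_{b ∈ births G} (d′_b + 1) + ε·partnerAges G` once all
mergers have step `≤ T`: the matching `youngerRoot G` feeds `youngerRoot_budget` at every step, its ages sum to
`partnerAges`, its classes are dominated by the births' (injectivity). [folklore] -/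
theorem merges_budget {ε θ : ℝ} (hε : 0 ≤ ε) (hθ : 0 ≤ θ) {G : Gen PEv} (hW : G.WF W) (hS : StepsOK PEv.step G)
    (hO : Ordered PEv.step G) (hk : ∀ b ∈ births G, b.kind = 0) {T : ℕ}
    (hT : ∀ e ∈ merges G, e.step ∈ range (T + 1)) :
    ∑ t ∈ range (T + 1), min ε (θ / 2) * (((mergesAt G t).card : ℝ) * Real.sqrt (mergesAt G t).card /
        (2 * Real.sqrt 2)) ≤ θ / 2 * ∑ b ∈ births G, ((b.fat : ℝ) + 1) + ε * (partnerAges PEv.step G : ℝ) := by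
  -- per step: the younger-root budget
  have h1 : ∀ t ∈ range (T + 1),
      min ε (θ / 2) * (((mergesAt G t).card : ℝ) * Real.sqrt (mergesAt G t).card / (2 * Real.sqrt 2)) ≤
        ∑ e ∈ mergesAt G t, (ε * ((t + 1 - (youngerRoot G e).step : ℕ) : ℝ) +
          θ / 2 * (((youngerRoot G e).fat : ℝ) + 1)) := by
    intro t _
    refine youngerRoot_budget hε hθ t (mergesAt G t) (youngerRoot G) ?_ ?_ ?_
    · exact (youngerRoot_injOn W hW).mono (coe_subset.2 (filter_subset _ _))
    · intro e he
      exact hk _ (youngerRoot_mem_births W hW e (mem_filter.1 he).1).1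
    · intro e he
      obtain ⟨he', hst⟩ := mem_filter.1 he
      have h := st_youngerRoot_le W PEv.step hW hS hO e he'
      rwa [hst] at h
  -- regroup the fibres into one sum over the mergers
  have h2 : ∑ t ∈ range (T + 1), ∑ e ∈ mergesAt G t, (ε * ((t + 1 - (youngerRoot G e).step : ℕ) : ℝ) +
        θ / 2 * (((youngerRoot G e).fat : ℝ) + 1)) =
      ∑ e ∈ merges G, (ε * ((e.step + 1 - (youngerRoot G e).step : ℕ) : ℝ) +
        θ / 2 * (((youngerRoot G e).fat : ℝ) + 1)) := by
    rw [← sum_fiberwise_of_maps_to hT]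
    refine sum_congr rfl fun t _ => sum_congr rfl fun e he => ?_
    rw [(mem_filter.1 he).2]
  -- the ages sum to `partnerAges`
  have h3 : ∑ e ∈ merges G, ε * ((e.step + 1 - (youngerRoot G e).step : ℕ) : ℝ) =
      ε * (partnerAges PEv.step G : ℝ) := by
    rw [← mul_sum, ← Nat.cast_sum, sum_age_youngerRoot W PEv.step hW hS]
  -- the classes are dominated by the births'
  have h4 : ∑ e ∈ merges G, θ / 2 * (((youngerRoot G e).fat : ℝ) + 1) ≤
      θ / 2 * ∑ b ∈ births G, ((b.fat : ℝ) + 1) := by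
    rw [← mul_sum]
    refine mul_le_mul_of_nonneg_left ?_ (by linarith)
    have hinj := youngerRoot_injOn W hW
    calc ∑ e ∈ merges G, (((youngerRoot G e).fat : ℝ) + 1)
        = ∑ b ∈ (merges G).image (youngerRoot G), ((b.fat : ℝ) + 1) :=
          (sum_image (f := fun b : PEv => ((b.fat : ℝ) + 1)) fun _ hx _ hx' h => hinj hx hx' h).symm
      _ ≤ ∑ b ∈ births G, ((b.fat : ℝ) + 1) :=
          sum_le_sum_of_subset_of_nonneg
            (image_subset_iff.2 fun e he => (youngerRoot_mem_births W hW e he).1)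
            fun _ _ _ => by positivity
  calc ∑ t ∈ range (T + 1), min ε (θ / 2) * (((mergesAt G t).card : ℝ) * Real.sqrt (mergesAt G t).card /
        (2 * Real.sqrt 2))
      ≤ ∑ t ∈ range (T + 1), ∑ e ∈ mergesAt G t, (ε * ((t + 1 - (youngerRoot G e).step : ℕ) : ℝ) +
          θ / 2 * (((youngerRoot G e).fat : ℝ) + 1)) := sum_le_sum h1
    _ = ∑ e ∈ merges G, ε * ((e.step + 1 - (youngerRoot G e).step : ℕ) : ℝ) +
          ∑ e ∈ merges G, θ / 2 * (((youngerRoot G e).fat : ℝ) + 1) := by rw [h2, sum_add_distrib]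
    _ ≤ θ / 2 * ∑ b ∈ births G, ((b.fat : ℝ) + 1) + ε * (partnerAges PEv.step G : ℝ) := by
          rw [h3]; linarith

/-! ## §4 The crowding theorem -/

/-- **THE CROWDING THEOREM.**  For a well-formed genealogy with consistent, ordered step data and births of kind `0`,
for every `p ≥ 0`, `σ ∈ (0,1)`, `ε > 0`, `θ > 0`:
`Σ_{e ∈ merges G} p·log Q(cnt G, σ, step e) ≤ θ·Σ_{b ∈ births G}(d′_b + 1) + ε·partnerAges G
  + crowdA p σ (min(ε,θ∕2)∕16)·#(births G ∪ merges G)`. [folklore] -/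
theorem crowding {p σ ε θ : ℝ} (hp : 0 ≤ p) (h0 : 0 < σ) (h1 : σ < 1) (hε : 0 < ε) (hθ : 0 < θ)
    {G : Gen PEv} (hW : G.WF W) (hS : StepsOK PEv.step G) (hO : Ordered PEv.step G)
    (hk : ∀ b ∈ births G, b.kind = 0) :
    ∑ e ∈ merges G, p * Real.log (Q (cnt G) σ e.step) ≤
      θ * ∑ b ∈ births G, ((b.fat : ℝ) + 1) + ε * (partnerAges PEv.step G : ℝ) +
        crowdA p σ (min ε (θ / 2) / 16) * ((bm G).card : ℝ) := by
  set T := horizon G with hTdef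
  have hμ₀ : 0 < min ε (θ / 2) := lt_min hε (by linarith)
  have hμθ : min ε (θ / 2) ≤ θ / 2 := min_le_right _ _
  have hη : 0 < min ε (θ / 2) / 16 := by positivity
  have hTb : ∀ b ∈ births G, b.step ∈ range (T + 1) := fun b hb => step_mem_range (mem_union_left _ hb)
  have hTm : ∀ e ∈ merges G, e.step ∈ range (T + 1) := fun e he => step_mem_range (mem_union_right _ he)
  have hTE : ∀ e ∈ bm G, e.step ∈ range (T + 1) := fun e he => step_mem_range he
  -- (i) regroup the cost by steps; `m_t ≤ n_t`
  have hi : ∑ e ∈ merges G, p * Real.log (Q (cnt G) σ e.step) ≤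
      ∑ t ∈ range (T + 1), p * (cnt G t) * Real.log (Q (cnt G) σ t) := by
    rw [← sum_fiberwise_of_maps_to hTm]
    refine sum_le_sum fun t _ => ?_
    have hft : ∑ e ∈ (merges G).filter (fun e => e.step = t), p * Real.log (Q (cnt G) σ e.step) =
        ((mergesAt G t).card : ℝ) * (p * Real.log (Q (cnt G) σ t)) := by
      rw [sum_congr rfl fun e he => by rw [(mem_filter.1 he).2], sum_const, nsmul_eq_mul, mergesAt]
    rw [hft]
    have hm : ((mergesAt G t).card : ℝ) ≤ cnt G t := by exact_mod_cast card_mergesAt_le_cnt G t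
    by_cases hL : 0 ≤ Real.log (Q (cnt G) σ t)
    · have : 0 ≤ p * Real.log (Q (cnt G) σ t) := mul_nonneg hp hL
      nlinarith
    · have hn0 : cnt G t = 0 := by
        by_contra hne
        have hge : (1 : ℝ) ≤ Q (cnt G) σ t :=
          le_trans (by exact_mod_cast Nat.one_le_iff_ne_zero.2 hne) (self_le_Q (cnt G) h0.le t)
        exact hL (Real.log_nonneg hge)
      have hm0 : (mergesAt G t).card = 0 := Nat.eq_zero_of_le_zero (hn0 ▸ card_mergesAt_le_cnt G t)
      simp [hm0, hn0]
  -- (ii) the analysis of part 2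
  have hii := cost_le hp h0 h1 hη (cnt G) T
  -- (iii) the budget of parts 1, 1b
  have hB := births_budget hk hTb
  have hM := merges_budget W hε.le hθ.le hW hS hO hk hTm
  have hsum : ∑ t ∈ range (T + 1), (cnt G t : ℝ) * Real.sqrt (cnt G t) ≤
      8 * (∑ t ∈ range (T + 1), ((birthsAt (births G) t).card : ℝ) * Real.sqrt (birthsAt (births G) t).card /
          (2 * Real.sqrt 2) +
        ∑ t ∈ range (T + 1), ((mergesAt G t).card : ℝ) * Real.sqrt (mergesAt G t).card / (2 * Real.sqrt 2)) := by
    rw [← sum_add_distrib, mul_sum]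
    exact sum_le_sum fun t _ => mul_sqrt_le_of_le_add (cnt_le hk t)
  have hM' : min ε (θ / 2) * ∑ t ∈ range (T + 1), ((mergesAt G t).card : ℝ) * Real.sqrt (mergesAt G t).card /
      (2 * Real.sqrt 2) ≤ θ / 2 * ∑ b ∈ births G, ((b.fat : ℝ) + 1) + ε * (partnerAges PEv.step G : ℝ) := by
    rw [mul_sum]; exact hM
  have hF : 0 ≤ ∑ b ∈ births G, ((b.fat : ℝ) + 1) := sum_nonneg fun _ _ => by positivity
  have hSB : 0 ≤ ∑ t ∈ range (T + 1), ((birthsAt (births G) t).card : ℝ) *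
      Real.sqrt (birthsAt (births G) t).card / (2 * Real.sqrt 2) := sum_nonneg fun _ _ => by positivity
  have hiii : 2 * (min ε (θ / 2) / 16) * ∑ t ∈ range (T + 1), (cnt G t : ℝ) * Real.sqrt (cnt G t) ≤
      θ * ∑ b ∈ births G, ((b.fat : ℝ) + 1) + ε * (partnerAges PEv.step G : ℝ) := by
    nlinarith [mul_le_mul_of_nonneg_left hsum hμ₀.le, mul_le_mul_of_nonneg_left hB hμ₀.le,
      mul_le_mul_of_nonneg_right hμθ hF, mul_le_mul_of_nonneg_right hμθ hSB]
  -- (iv) the event count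
  have hiv : ∑ t ∈ range (T + 1), (cnt G t : ℝ) = (bm G).card := by
    rw [card_eq_sum_card_fiberwise hTE, Nat.cast_sum]
    rfl
  rw [← hiv]
  linarith [hi, hii, hiii]

/-- **PRODUCT FORM.**  `∏_{e ∈ merges G} Q(cnt G, σ, step e)^p ≤ exp(θ·Σ_births(d′+1) + ε·partnerAges + crowdA·#events)`
(real powers; every factor is `≥ 1`). [folklore] -/
theorem prod_rpow_Q_le {p σ ε θ : ℝ} (hp : 0 ≤ p) (h0 : 0 < σ) (h1 : σ < 1) (hε : 0 < ε) (hθ : 0 < θ)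
    {G : Gen PEv} (hW : G.WF W) (hS : StepsOK PEv.step G) (hO : Ordered PEv.step G)
    (hk : ∀ b ∈ births G, b.kind = 0) :
    ∏ e ∈ merges G, Q (cnt G) σ e.step ^ p ≤
      Real.exp (θ * ∑ b ∈ births G, ((b.fat : ℝ) + 1) + ε * (partnerAges PEv.step G : ℝ) +
        crowdA p σ (min ε (θ / 2) / 16) * ((bm G).card : ℝ)) := by
  have hpos : ∀ e ∈ merges G, 0 < Q (cnt G) σ e.step :=
    fun e he => lt_of_lt_of_le zero_lt_one (one_le_Q_of_mem h0.le he)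
  have hpos' : ∀ e ∈ merges G, 0 < Q (cnt G) σ e.step ^ p := fun e he => Real.rpow_pos_of_pos (hpos e he) p
  rw [← Real.exp_log (prod_pos hpos'), Real.exp_le_exp, Real.log_prod (hf := fun e he => (hpos' e he).ne')]
  calc ∑ e ∈ merges G, Real.log (Q (cnt G) σ e.step ^ p) = ∑ e ∈ merges G, p * Real.log (Q (cnt G) σ e.step) :=
        sum_congr rfl fun e he => Real.log_rpow (hpos e he) p
    _ ≤ _ := crowding W hp h0 h1 hε hθ hW hS hO hk

/-! ## §5 Sanity (closed instances; not used elsewhere) -/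

namespace Sanity

/-- two births at step `0` (classes `0`, `1`) merged at step `0` by the event `(0, 2, 0)`: three formation events at
step `0` -/
theorem cnt_example :
    cnt (Gen.merge (Gen.born ((0, 0, 0) : PEv) 0) (Gen.born (0, 0, 1) 0) (0, 2, 0)) 0 = 3 := by decide

/-- and one merger at step `0` -/
theorem mergesAt_example :
    mergesAt (Gen.merge (Gen.born ((0, 0, 0) : PEv) 0) (Gen.born (0, 0, 1) 0) (0, 2, 0)) 0 = {(0, 2, 0)} := by
  decide

end Sanity

end

end Summit.QuantumFields.BalabanUV.T4Continuum.Crowding
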